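import Summits.HodgeConjecture.CorCM.TwoSexticFieldsPowersHodgeOfMarkman
import Summits.HodgeConjecture.CorCM.TwoSexticFieldsSeparation
import Summits.HodgeConjecture.CorCM.DihedralSexticPairCurveHodgeOfMarkmanSimple
import HarnessLib

/-!
# COR-CM — the Hodge conjecture, modulo Markman's fourfold theorem, for ALL products of copies of `E`, `B₁`, `B₂`:
# two simple CM threefolds with NON-ISOMORPHIC non-Galois sextic CM fields sharing an imaginary quadratic field

Cell `pub-hodgecm2` (COR-CM = stage 2 of the Hodge ladder), seat b30 gen 16 (2026-08-21); COUNT-NEUTRAL (no row of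
`HOME/BINDER-OWNERS.md`); theorems only, no definition, no named fact, no `sorry`.  Final file of the series
TWO-FIELD-PAIR (`TwoSexticFieldsFrameTransfer` → `…PairStructure` → `…Generators` → `…PowersHodgeOfMarkman`, and
`…JointFrame` → `…Separation`).

MAIN THEOREM (`hodgeConjectureFor_biproduct_comp_vec_of_markman`).  Let `k` be an imaginary quadratic field and
`K₁`, `K₂` two sextic CM fields containing `k` (`i_m : k →+* K_m`), both NOT Galois over `ℚ` (i.e. `K_m = k·F_m` with
`F_m` a non-cyclic totally real cubic) and NOT ISOMORPHIC (`Hom(K₁, K₂) = ∅`).  Let `E ⊨ (k; Ψ)` be a CM elliptic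
curve and `B₁ ⊨ (K₁; Φ₁)`, `B₂ ⊨ (K₂; Φ₂)` abelian threefolds realising CM types NOT induced from `k` (e.g. `B₁`, `B₂`
SIMPLE: `hodgeConjectureFor_biproduct_comp_vec_of_isSimple_of_markman`).  Then for EVERY slot map
`κ : Fin N → Fin 3` — i.e. for every product `E^c × B₁^a × B₂^b` of copies in any number and order — every rational
`(p,p)`-class on `⨁_j ![E, B₁, B₂] (κ j)` is algebraic, GIVEN ONLY `Markman2025_weilClasses_algebraic_abelianFourfold`;
hence (§3) the Hodge conjecture for `B₁ × B₂`, for every abelian variety isogenous to a product of copies of `E`, `B₁`,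
`B₂`, for all powers of such, and for everything they dominate.

WHY THIS IS THE INTERESTING CASE.  By b23's `SharedImaginaryQuadraticCMFieldsHodge.exists_exceptional_prod_of_isSimple_
of_shared_imaginary_quadratic` a shared imaginary quadratic subfield FORCES exceptional (non-divisorial) Hodge classes
on `B₁ × B₂` (the Mumford–Tate group of the pair has corank `1`: the common odd character of `k`), so `B• ≠ D•` and
the divisor method says nothing; here those classes — the `k`-Weil `(3,3)`-classes of the sixfold `B₁ × B₂` and their
relatives on the powers — are shown algebraic modulo Markman.

MECHANISM.  Two frames `e_m : Hom(K_m, ℂ) ≃ ℤ/3 × Bool` normalised INDEPENDENTLY (`Φ₁ ↔` place `0`, `Φ₂ ↔` place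
`1`, after conjugating a structure if necessary: `exists_realisation_card_fibre_eq_one₁`, `exists_frame_place`); the
JOINT Galois hypothesis from `Hom(K₁, K₂) = ∅` (`exists_fix_move_of_isEmpty` + Goursat `exists_joint_he_gal`); then the
14-point model of gens 14/15 (census, sign-defect induction, distribution lemma) and the three generators modulo
Markman (`CorCM/TwoSexticFieldsPowersHodgeOfMarkman.lean`).  HONEST FRAMING: conditional on Markman's theorem only;
nothing is asserted about `HC_CM`; wording of record untouched.

## References
* [Markman2025SurveySecant] E. Markman, arXiv:2509.23403, Thm. 1.2 and §11.5 Step 2 (the displayed hypothesis).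
* [Pohlmann1968] H. Pohlmann, Ann. of Math. 88 (1968), Thm 1.  [GaoUllmo2025] J. Inst. Math. Jussieu 25, Thm 3.1.
* [MoonenZarhin1999LowDim] B. Moonen, Yu. Zarhin, Duke Math. J. 98 (1999), Thm. 0.1.  [Shimura1998] §5.2, §8.2, §8.4,
  §18.2.  [Lang2002] S. Lang, *Algebra*, I §12 Ex. 5, VI §1.  [MumfordAV1970] §19.
-/

noncomputable section

open CategoryTheory CategoryTheory.Limits NumberField

namespace Summit.HodgeConjecture.CorCM.TwoSexticFields

open Literature.AlgebraicGeometry Literature.AlgebraicGeometry.Motives Literature.AlgebraicGeometry.HodgeTheory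
open Literature.AlgebraicGeometry.ComplexMultiplication (IsCMTypeRealisation)

/-- `decide (x = p) = decide (x.val = p.val)` on `ℤ/3` (reading a place as its index). [folklore] -/
theorem zmod3_decide_eq_decide_val : ∀ x p : ZMod 3, decide (x = p) = decide (x.val = p.val) := by
  decide

section Vec

variable {k K₁ K₂ : Type} [Field k] [NumberField k] [IsCMField k] [Field K₁] [NumberField K₁] [IsCMField K₁]
  [Field K₂] [NumberField K₂] [IsCMField K₂] {N : ℕ} (κ : Fin N → Fin 3)
  {E : AbelianVariety ℂ} {Ψ : CMType k} {ιE : 𝓞 k →+* End E} {θE : k →+* Module.End ℂ (complexBetti E.X 1)}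
  {B₁ B₂ : AbelianVariety ℂ} {Φ₁ : CMType K₁} {Φ₂ : CMType K₂} {ι₁ : 𝓞 K₁ →+* End B₁} {ι₂ : 𝓞 K₂ →+* End B₂}
  {θ₁ : K₁ →+* Module.End ℂ (complexBetti B₁.X 1)} {θ₂ : K₂ →+* Module.End ℂ (complexBetti B₂.X 1)}

/-- **MAIN THEOREM.  The Hodge conjecture for ALL products of copies `E^c × B₁^a × B₂^b` — two threefolds with CM by
NON-ISOMORPHIC non-Galois sextic CM fields `K₁`, `K₂` sharing the imaginary quadratic field `k` — modulo Markman's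
fourfold theorem.**  `[k:ℚ] = 2`, `[K_m:ℚ] = 6`, `i_m : k →+* K_m`, `K_m/ℚ` not Galois, `Hom(K₁, K₂) = ∅`; `E ⊨ (k; Ψ)`,
`B_m ⊨ (K_m; Φ_m)` with `Φ_m` not induced from `k` (`hprim_m`).  Then every rational `(p,p)`-class on
`⨁_j ![E, B₁, B₂] (κ j)` is algebraic, for every `κ : Fin N → Fin 3` and every `p`, GIVEN ONLY
`Markman2025_weilClasses_algebraic_abelianFourfold`. [cite: Markman2025SurveySecant, Thm. 1.2 and §11.5 Step 2]
[cite: Pohlmann1968, Thm 1] [cite: GaoUllmo2025, Thm 3.1] [cite: MoonenZarhin1999LowDim, Thm. 0.1]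
[cite: Shimura1998, §5.2, §8.4, §18.2] [cite: Lang2002, I §12 Ex. 5, VI §1] -/
theorem hodgeConjectureFor_biproduct_comp_vec_of_markman (hW4 : Markman2025_weilClasses_algebraic_abelianFourfold)
    (h2 : Module.finrank ℚ k = 2) (h6₁ : Module.finrank ℚ K₁ = 6) (h6₂ : Module.finrank ℚ K₂ = 6)
    (i₁ : k →+* K₁) (i₂ : k →+* K₂) (hK₁ : ¬ IsGalois ℚ K₁) (hK₂ : ¬ IsGalois ℚ K₂) (h12 : IsEmpty (K₁ →+* K₂))
    (hE : IsCMTypeRealisation Ψ E ιE θE) (hB₁ : IsCMTypeRealisation Φ₁ B₁ ι₁ θ₁)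
    (hB₂ : IsCMTypeRealisation Φ₂ B₂ ι₂ θ₂)
    (hprim₁ : ∃ s ∈ Φ₁.1, ∃ s' ∈ Φ₁.1, s.comp i₁ ≠ s'.comp i₁)
    (hprim₂ : ∃ s ∈ Φ₂.1, ∃ s' ∈ Φ₂.1, s.comp i₂ ≠ s'.comp i₂) :
    HodgeConjectureFor (⨁ fun j => (![E, B₁, B₂] : Fin 3 → AbelianVariety ℂ) (κ j)).dim
      (⨁ fun j => (![E, B₁, B₂] : Fin 3 → AbelianVariety ℂ) (κ j)).X := by
  classical
  -- `τ :=` the member of the curve's type, `δ ∈ 𝓞_k` with `τ(δ) = i√d`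
  obtain ⟨τ, hΨ⟩ := QuarticCM.exists_mem_iff_eq_of_quadratic h2 Ψ
  obtain ⟨δ, d, hd, hδ, hτ⟩ : ∃ (δ : 𝓞 k) (d : ℕ), 0 < d ∧ ((δ : k)) ^ 2 = -(d : k) ∧
      τ (δ : k) = Complex.I * (Real.sqrt d : ℂ) := by
    obtain ⟨δ, d, hd, hδ⟩ := CyclicSextic.exists_sq_eq_neg_nat_of_isTotallyComplex k h2
    obtain ⟨τ₀, hτ₀⟩ := WeilFourfold.exists_apply_eq_I_mul_sqrt hδ
    rcases DihedralSexticPair.eq_or_eq_conjugate h2 hd hτ₀ τ with rfl | rfl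
    · exact ⟨δ, d, hd, hδ, hτ₀⟩
    · refine ⟨-δ, d, hd, by push_cast; rw [neg_sq]; exact hδ, ?_⟩
      push_cast
      rw [map_neg, ComplexEmbedding.conjugate_coe_eq, hτ₀, map_mul, Complex.conj_I, Complex.conj_ofReal]
      ring
  have hττ : ComplexEmbedding.conjugate τ ≠ τ := CMThreefoldPair.conjugate_ne_of_apply_eq hd hτ
  have hdich₁ : ∀ s : K₁ →+* ℂ, s.comp i₁ = τ ∨ s.comp i₁ = ComplexEmbedding.conjugate τ := fun s =>
    DihedralSexticPair.eq_or_eq_conjugate h2 hd hτ (s.comp i₁)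
  have hdich₂ : ∀ s : K₂ →+* ℂ, s.comp i₂ = τ ∨ s.comp i₂ = ComplexEmbedding.conjugate τ := fun s =>
    DihedralSexticPair.eq_or_eq_conjugate h2 hd hτ (s.comp i₂)
  -- normalise the two threefold structures: one member of the type over `τ`
  obtain ⟨Φ₁', ι₁', θ₁', hB₁', hone₁⟩ := exists_realisation_card_fibre_eq_one₁ hττ hdich₁ h6₁ hB₁ hprim₁
  obtain ⟨Φ₂', ι₂', θ₂', hB₂', hone₂⟩ := exists_realisation_card_fibre_eq_one₁ hττ hdich₂ h6₂ hB₂ hprim₂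
  -- the two frames: `Φ₁' ↔` place `0`, `Φ₂' ↔` place `1`
  obtain ⟨t₁, e₁, ht₁, hti₁, htcov₁, het₁, hec₁, hcases₁, he_conj₁, he_sign₁, hΦ₁⟩ :=
    exists_frame_place hττ hdich₁ hK₁ h6₁ hone₁ 0
  obtain ⟨t₂, e₂, ht₂, hti₂, htcov₂, het₂, hec₂, hcases₂, he_conj₂, he_sign₂, hΦ₂⟩ :=
    exists_frame_place hττ hdich₂ hK₂ h6₂ hone₂ 1
  -- the separation hypotheses from `Hom(K₁, K₂) = ∅`, and the joint Galois hypothesis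
  have h21 : IsEmpty (K₂ →+* K₁) :=
    ⟨fun f => h12.false (nonempty_ringHom_symm_of_finrank_eq f (h6₁.trans h6₂.symm)).some⟩
  have hsep₁ := exists_fix_move_of_isEmpty ht₁ hti₁ htcov₁ ht₂ hti₂ htcov₂ h12
  have hsep₂ := exists_fix_move_of_isEmpty ht₂ hti₂ htcov₂ ht₁ hti₁ htcov₁ h21
  have hgal : ∀ (j : ZMod 3) (f : Bool), ∃ σ : ℂ ≃+* ℂ,
      (∀ s : K₁ →+* ℂ, e₁ ((σ : ℂ →+* ℂ).comp s) = ((if f then -(e₁ s).1 else (e₁ s).1) + j, (e₁ s).2)) ∧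
      (∀ s : K₂ →+* ℂ, e₂ ((σ : ℂ →+* ℂ).comp s) = ((if f then -(e₂ s).1 else (e₂ s).1) + j, (e₂ s).2)) :=
    fun j f => exists_joint_he_gal hττ hdich₁ hdich₂ ht₁ hti₁ htcov₁ ht₂ hti₂ htcov₂ hK₁ hK₂ hsep₁ hsep₂ het₁ hec₁
      hcases₁ het₂ hec₂ hcases₂ j f
  -- the family of fields `(k, K₁, K₂)` with its instances (all identifications below are definitional)
  let Kf : Fin 3 → Type := Fin.cons k (Fin.cons K₁ (Fin.cons K₂ finZeroElim))
  letI instF : ∀ j, Field (Kf j) := Fin.cons ‹Field k› (Fin.cons ‹Field K₁› (Fin.cons ‹Field K₂› finZeroElim))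
  letI instN : ∀ j, NumberField (Kf j) :=
    Fin.cons ‹NumberField k› (Fin.cons ‹NumberField K₁› (Fin.cons ‹NumberField K₂› finZeroElim))
  haveI instC : ∀ j, IsCMField (Kf j) :=
    Fin.cons ‹IsCMField k› (Fin.cons ‹IsCMField K₁› (Fin.cons ‹IsCMField K₂› finZeroElim))
  let tl : Fin 2 → Fin 3 := ![1, 2]
  -- the data over the three slots `(0, tl 0, tl 1) = (0, 1, 2)`
  let Φ₃ : ∀ j : Fin 3, CMType (Kf (slots (0 : Fin 3) tl j)) := Fin.cons Ψ (Fin.cons Φ₁' (Fin.cons Φ₂' finZeroElim))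
  let ι₃ : ∀ j : Fin 3, 𝓞 (Kf (slots (0 : Fin 3) tl j)) →+* End ((![E, B₁, B₂] : Fin 3 → AbelianVariety ℂ) j) :=
    Fin.cons ιE (Fin.cons ι₁' (Fin.cons ι₂' finZeroElim))
  let θ₃ : ∀ j : Fin 3, Kf (slots (0 : Fin 3) tl j) →+*
      Module.End ℂ (complexBetti ((![E, B₁, B₂] : Fin 3 → AbelianVariety ℂ) j).X 1) :=
    Fin.cons θE (Fin.cons θ₁' (Fin.cons θ₂' finZeroElim))
  have hA : ∀ j, IsCMTypeRealisation (Φ₃ j) ((![E, B₁, B₂] : Fin 3 → AbelianVariety ℂ) j) (ι₃ j) (θ₃ j) :=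
    Fin.cons hE (Fin.cons hB₁' (Fin.cons hB₂' finZeroElim))
  let e : ∀ m : Fin 2, (Kf (tl m) →+* ℂ) ≃ ZMod 3 × Bool := Fin.cons e₁ (Fin.cons e₂ finZeroElim)
  let i : ∀ m : Fin 2, Kf 0 →+* Kf (tl m) := Fin.cons i₁ (Fin.cons i₂ finZeroElim)
  have h6 : ∀ m : Fin 2, Module.finrank ℚ (Kf (tl m)) = 6 := Fin.cons h6₁ (Fin.cons h6₂ finZeroElim)
  have he_conj : ∀ (m : Fin 2) (s : Kf (tl m) →+* ℂ),
      e m (ComplexEmbedding.conjugate s) = ((e m s).1, !(e m s).2) :=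
    Fin.cons he_conj₁ (Fin.cons he_conj₂ finZeroElim)
  have he_sign : ∀ (m : Fin 2) (s : Kf (tl m) →+* ℂ), s.comp (i m) = τ ↔ (e m s).2 = true :=
    Fin.cons he_sign₁ (Fin.cons he_sign₂ finZeroElim)
  have he_gal : ∀ (j : ZMod 3) (f : Bool), ∃ σ : ℂ ≃+* ℂ, ∀ (m : Fin 2) (s : Kf (tl m) →+* ℂ),
      e m ((σ : ℂ →+* ℂ).comp s) = ((if f then -(e m s).1 else (e m s).1) + j, (e m s).2) := by
    intro j f
    obtain ⟨σ, hσ₁, hσ₂⟩ := hgal j f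
    exact ⟨σ, Fin.cons hσ₁ (Fin.cons hσ₂ finZeroElim)⟩
  have hΦ : ∀ (m : Fin 2) (s : Kf (tl m) →+* ℂ),
      s ∈ (Φ₃ m.succ).1 ↔ (e m s).2 = decide ((e m s).1.val = m.val) := by
    refine Fin.cons (fun s => (hΦ₁ s).trans ?_) (Fin.cons (fun s => (hΦ₂ s).trans ?_) finZeroElim)
    · rw [zmod3_decide_eq_decide_val]; exact Iff.rfl
    · rw [zmod3_decide_eq_decide_val]; exact Iff.rfl
  exact hodgeConjectureFor_biproduct_comp_of_frames_of_markman (Kf := Kf) (i₀ := 0) (tl := tl)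
    (A₃ := (![E, B₁, B₂] : Fin 3 → AbelianVariety ℂ)) (Φ₃ := Φ₃) (ι₃ := ι₃) (θ₃ := θ₃) κ hW4 h6 h2 i hd hδ hτ hA
    e he_conj he_sign he_gal hΨ hΦ

/-- **The same with `B₁`, `B₂` SIMPLE** (a simple CM threefold of a sextic field containing `k` has a type not induced
from `k`: gen 14's `DihedralSexticPair.exists_mem_comp_ne_of_isSimple`). [cite: Markman2025SurveySecant, Thm. 1.2]
[cite: Shimura1998, §8.2 Prop. 26, §8.4] -/
theorem hodgeConjectureFor_biproduct_comp_vec_of_isSimple_of_markman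
    (hW4 : Markman2025_weilClasses_algebraic_abelianFourfold)
    (h2 : Module.finrank ℚ k = 2) (h6₁ : Module.finrank ℚ K₁ = 6) (h6₂ : Module.finrank ℚ K₂ = 6)
    (i₁ : k →+* K₁) (i₂ : k →+* K₂) (hK₁ : ¬ IsGalois ℚ K₁) (hK₂ : ¬ IsGalois ℚ K₂) (h12 : IsEmpty (K₁ →+* K₂))
    (hE : IsCMTypeRealisation Ψ E ιE θE) (hB₁ : IsCMTypeRealisation Φ₁ B₁ ι₁ θ₁)
    (hB₂ : IsCMTypeRealisation Φ₂ B₂ ι₂ θ₂) (hS₁ : B₁.IsSimple) (hS₂ : B₂.IsSimple) :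
    HodgeConjectureFor (⨁ fun j => (![E, B₁, B₂] : Fin 3 → AbelianVariety ℂ) (κ j)).dim
      (⨁ fun j => (![E, B₁, B₂] : Fin 3 → AbelianVariety ℂ) (κ j)).X :=
  hodgeConjectureFor_biproduct_comp_vec_of_markman κ hW4 h2 h6₁ h6₂ i₁ i₂ hK₁ hK₂ h12 hE hB₁ hB₂
    (DihedralSexticPair.exists_mem_comp_ne_of_isSimple h6₁ h2 i₁ hB₁ hS₁)
    (DihedralSexticPair.exists_mem_comp_ne_of_isSimple h6₂ h2 i₂ hB₂ hS₂)

/-- **Every abelian variety dominated by a product of copies of `E`, `B₁`, `B₂`** (abelian subvarieties, quotients,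
isogeny factors of `E^c × B₁^a × B₂^b`), modulo Markman. [cite: Markman2025SurveySecant, Thm. 1.2] [cite: MumfordAV1970, §19] -/
theorem hodgeConjectureFor_of_avDominatedBy_comp_vec_of_markman
    (hW4 : Markman2025_weilClasses_algebraic_abelianFourfold)
    (h2 : Module.finrank ℚ k = 2) (h6₁ : Module.finrank ℚ K₁ = 6) (h6₂ : Module.finrank ℚ K₂ = 6)
    (i₁ : k →+* K₁) (i₂ : k →+* K₂) (hK₁ : ¬ IsGalois ℚ K₁) (hK₂ : ¬ IsGalois ℚ K₂) (h12 : IsEmpty (K₁ →+* K₂))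
    (hE : IsCMTypeRealisation Ψ E ιE θE) (hB₁ : IsCMTypeRealisation Φ₁ B₁ ι₁ θ₁)
    (hB₂ : IsCMTypeRealisation Φ₂ B₂ ι₂ θ₂) (hS₁ : B₁.IsSimple) (hS₂ : B₂.IsSimple)
    {B : AbelianVariety ℂ}
    (hB : Domination.AVDominatedBy B (⨁ fun j => (![E, B₁, B₂] : Fin 3 → AbelianVariety ℂ) (κ j))) :
    HodgeConjectureFor B.dim B.X :=
  Domination.hodgeConjectureFor_of_avDominatedBy
    (hodgeConjectureFor_biproduct_comp_vec_of_isSimple_of_markman κ hW4 h2 h6₁ h6₂ i₁ i₂ hK₁ hK₂ h12 hE hB₁ hB₂ hS₁ hS₂)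
    hB

end Vec

/-! ## Every abelian variety isogenous to a product of copies of `E`, `B₁`, `B₂`; all powers; `B₁ × B₂` -/

section Isogenous

variable {k K₁ K₂ : Type} [Field k] [NumberField k] [IsCMField k] [Field K₁] [NumberField K₁] [IsCMField K₁]
  [Field K₂] [NumberField K₂] [IsCMField K₂]
  {E : AbelianVariety ℂ} {Ψ : CMType k} {ιE : 𝓞 k →+* End E} {θE : k →+* Module.End ℂ (complexBetti E.X 1)}
  {B₁ B₂ : AbelianVariety ℂ} {Φ₁ : CMType K₁} {Φ₂ : CMType K₂} {ι₁ : 𝓞 K₁ →+* End B₁} {ι₂ : 𝓞 K₂ →+* End B₂}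
  {θ₁ : K₁ →+* Module.End ℂ (complexBetti B₁.X 1)} {θ₂ : K₂ →+* Module.End ℂ (complexBetti B₂.X 1)}

/-- **The Hodge conjecture for every abelian variety ISOGENOUS TO A PRODUCT OF COPIES of `E`, `B₁`, `B₂`** (indexed by
any finite type `J`, `X ∼ ⨁_{j : J} ![E, B₁, B₂] (cls j)`), modulo Markman. [cite: Markman2025SurveySecant, Thm. 1.2]
[cite: MumfordAV1970, §19] -/
theorem hodgeConjectureFor_of_isIsogenous_biproduct_comp_of_markman
    (hW4 : Markman2025_weilClasses_algebraic_abelianFourfold)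
    (h2 : Module.finrank ℚ k = 2) (h6₁ : Module.finrank ℚ K₁ = 6) (h6₂ : Module.finrank ℚ K₂ = 6)
    (i₁ : k →+* K₁) (i₂ : k →+* K₂) (hK₁ : ¬ IsGalois ℚ K₁) (hK₂ : ¬ IsGalois ℚ K₂) (h12 : IsEmpty (K₁ →+* K₂))
    (hE : IsCMTypeRealisation Ψ E ιE θE) (hB₁ : IsCMTypeRealisation Φ₁ B₁ ι₁ θ₁)
    (hB₂ : IsCMTypeRealisation Φ₂ B₂ ι₂ θ₂) (hS₁ : B₁.IsSimple) (hS₂ : B₂.IsSimple)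
    {J : Type} [Fintype J] (cls : J → Fin 3) {X : AbelianVariety ℂ}
    (hX : AbelianVariety.IsIsogenous X (⨁ fun j => (![E, B₁, B₂] : Fin 3 → AbelianVariety ℂ) (cls j))) :
    HodgeConjectureFor X.dim X.X := by
  classical
  let ε : Fin (Fintype.card J) ≃ J := (Fintype.equivFin J).symm
  have eJ : (⨁ fun j => (![E, B₁, B₂] : Fin 3 → AbelianVariety ℂ) (cls j)) ≅
      ⨁ fun l => (![E, B₁, B₂] : Fin 3 → AbelianVariety ℂ) (cls (ε l)) :=
    (biproduct.reindex ε fun j => (![E, B₁, B₂] : Fin 3 → AbelianVariety ℂ) (cls j)).symm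
  exact hodgeConjectureFor_of_avDominatedBy_comp_vec_of_markman (fun l => cls (ε l)) hW4 h2 h6₁ h6₂ i₁ i₂ hK₁ hK₂ h12
    hE hB₁ hB₂ hS₁ hS₂ (Domination.AVDominatedBy.of_isIsogenous hX ((Domination.AVDominatedBy.refl _).of_iso_right eJ))

/-- **… and ALL POWERS of such an abelian variety** (`X^{N+1}` is an isogeny factor of a product of copies), modulo
Markman: `X` is «stably Hodge» granted Markman's theorem, although `B•(Xⁿ) ≠ D•(Xⁿ)` in general.
[cite: Markman2025SurveySecant, Thm. 1.2] [cite: Gordon1999HodgeAVSurvey, 7.6.1] [cite: MumfordAV1970, §19] -/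
theorem hodgeConjectureFor_powSucc_of_isIsogenous_biproduct_comp_of_markman
    (hW4 : Markman2025_weilClasses_algebraic_abelianFourfold)
    (h2 : Module.finrank ℚ k = 2) (h6₁ : Module.finrank ℚ K₁ = 6) (h6₂ : Module.finrank ℚ K₂ = 6)
    (i₁ : k →+* K₁) (i₂ : k →+* K₂) (hK₁ : ¬ IsGalois ℚ K₁) (hK₂ : ¬ IsGalois ℚ K₂) (h12 : IsEmpty (K₁ →+* K₂))
    (hE : IsCMTypeRealisation Ψ E ιE θE) (hB₁ : IsCMTypeRealisation Φ₁ B₁ ι₁ θ₁)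
    (hB₂ : IsCMTypeRealisation Φ₂ B₂ ι₂ θ₂) (hS₁ : B₁.IsSimple) (hS₂ : B₂.IsSimple)
    {J : Type} [Fintype J] (cls : J → Fin 3) {X : AbelianVariety ℂ}
    (hX : AbelianVariety.IsIsogenous X (⨁ fun j => (![E, B₁, B₂] : Fin 3 → AbelianVariety ℂ) (cls j))) (N : ℕ) :
    HodgeConjectureFor (X.powSucc N).dim (X.powSucc N).X := by
  obtain ⟨n, ρ, hdom⟩ := exists_avDominatedBy_powSucc_biproduct_slots_of_isIsogenous hX N
  exact hodgeConjectureFor_of_avDominatedBy_comp_vec_of_markman ρ hW4 h2 h6₁ h6₂ i₁ i₂ hK₁ hK₂ h12 hE hB₁ hB₂ hS₁ hS₂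
    hdom

/-- **THE HEADLINE CASE `B₁ × B₂`.**  Two SIMPLE abelian threefolds `B₁ ⊨ (K₁; Φ₁)`, `B₂ ⊨ (K₂; Φ₂)` with CM by
NON-ISOMORPHIC non-Galois sextic CM fields sharing the imaginary quadratic field `k` satisfy the Hodge conjecture on
`B₁ × B₂` GIVEN ONLY Markman's fourfold theorem — although `B₁ × B₂` carries exceptional Hodge classes (b23's
`exists_exceptional_prod_of_isSimple_of_shared_imaginary_quadratic`): they are the `k`-Weil `(3,3)`-classes, algebraic
by the elliptic completions `B₁ × E′`, `E′ × B₂` (gen 13).  `E` is auxiliary here (any CM curve of `k` realising a type on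
`H¹`; the tree's `cmAbelianVarietyRealised_holds` supplies one). [cite: Markman2025SurveySecant, Thm. 1.2 and §11.5 Step 2]
[cite: MoonenZarhin1999LowDim, Thm. 0.1] [cite: Shimura1998, §8.2 Prop. 26] -/
theorem hodgeConjectureFor_prod_of_isSimple_of_markman (hW4 : Markman2025_weilClasses_algebraic_abelianFourfold)
    (h2 : Module.finrank ℚ k = 2) (h6₁ : Module.finrank ℚ K₁ = 6) (h6₂ : Module.finrank ℚ K₂ = 6)
    (i₁ : k →+* K₁) (i₂ : k →+* K₂) (hK₁ : ¬ IsGalois ℚ K₁) (hK₂ : ¬ IsGalois ℚ K₂) (h12 : IsEmpty (K₁ →+* K₂))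
    (hE : IsCMTypeRealisation Ψ E ιE θE) (hB₁ : IsCMTypeRealisation Φ₁ B₁ ι₁ θ₁)
    (hB₂ : IsCMTypeRealisation Φ₂ B₂ ι₂ θ₂) (hS₁ : B₁.IsSimple) (hS₂ : B₂.IsSimple) :
    HodgeConjectureFor (B₁.prod B₂).dim (B₁.prod B₂).X := by
  -- `B₁ × B₂ ≅ ⨁ ![B₁, B₂] ≅ ⨁_j ![E, B₁, B₂] (![1, 2] j)`
  have e12 : (⨁ (![B₁, B₂] : Fin 2 → AbelianVariety ℂ)) ≅
      ⨁ fun j => (![E, B₁, B₂] : Fin 3 → AbelianVariety ℂ) ((![1, 2] : Fin 2 → Fin 3) j) :=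
    biproduct.mapIso (Fin.cons (Iso.refl _) (Fin.cons (Iso.refl _) finZeroElim))
  have h := hodgeConjectureFor_of_isIsogenous_biproduct_comp_of_markman hW4 h2 h6₁ h6₂ i₁ i₂ hK₁ hK₂ h12 hE hB₁ hB₂
    hS₁ hS₂ (![1, 2] : Fin 2 → Fin 3) (X := ⨁ (![B₁, B₂] : Fin 2 → AbelianVariety ℂ))
    ⟨e12.hom, AbelianVariety.isIsogeny_hom_of_iso e12⟩
  exact PairWeights.hodgeConjectureFor_prod_of_biproduct (A := (![B₁, B₂] : Fin 2 → AbelianVariety ℂ)) h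

/-- **`B₁ × B₂` without the auxiliary curve in the statement**: two SIMPLE abelian threefolds with CM by NON-ISOMORPHIC
non-Galois sextic CM fields `K₁`, `K₂` sharing the imaginary quadratic field `k` satisfy the Hodge conjecture on
`B₁ × B₂`, GIVEN ONLY Markman's fourfold theorem (a CM elliptic curve of `k` exists by the tree's
`cmAbelianVarietyRealised_holds`, Shimura §6.2 Thm. 3). [cite: Markman2025SurveySecant, Thm. 1.2 and §11.5 Step 2]
[cite: MoonenZarhin1999LowDim, Thm. 0.1] [cite: Shimura1998, §6.2 Thm. 3, §8.2 Prop. 26] -/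
theorem hodgeConjectureFor_prod_of_isSimple_of_markman' (hW4 : Markman2025_weilClasses_algebraic_abelianFourfold)
    (h2 : Module.finrank ℚ k = 2) (h6₁ : Module.finrank ℚ K₁ = 6) (h6₂ : Module.finrank ℚ K₂ = 6)
    (i₁ : k →+* K₁) (i₂ : k →+* K₂) (hK₁ : ¬ IsGalois ℚ K₁) (hK₂ : ¬ IsGalois ℚ K₂) (h12 : IsEmpty (K₁ →+* K₂))
    (hB₁ : IsCMTypeRealisation Φ₁ B₁ ι₁ θ₁) (hB₂ : IsCMTypeRealisation Φ₂ B₂ ι₂ θ₂) (hS₁ : B₁.IsSimple)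
    (hS₂ : B₂.IsSimple) : HodgeConjectureFor (B₁.prod B₂).dim (B₁.prod B₂).X := by
  obtain ⟨τ⟩ : Nonempty (k →+* ℂ) := inferInstance
  obtain ⟨E, ιE, θE, hE⟩ :=
    cmAbelianVarietyRealised_holds k (Literature.NumberTheory.ComplexMultiplication.CMTypeCount.single h2 τ)
  exact hodgeConjectureFor_prod_of_isSimple_of_markman hW4 h2 h6₁ h6₂ i₁ i₂ hK₁ hK₂ h12 hE hB₁ hB₂ hS₁ hS₂

end Isogenous

end Summit.HodgeConjecture.CorCM.TwoSexticFields

end
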